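import Summits.ResolutionOfSingularities.ResolutionOfSingularities.Theorems.PurelyInseparableDim4ResConeCInfCornerTailPrime
import Summits.ResolutionOfSingularities.ResolutionOfSingularities.Theorems.PurelyInseparableDim4ResConeCInfGameWindowPrime
import HarnessLib
import HarnessLib.Audit.Tags

/-!
# Purely inseparable four-folds — the C∞ WINDOW CANNOT BE PLAYED, EVERY PRIME: after a letter change `λμ`, `4p − 6` further pure
# corner slot steps of straight isolated light-pair power-cone states with the exact pair ledger are impossible
# (cell `res-dim4-pi`, K2(p) lane, rung-1 power-cone line «light pair of TAIL(p, p−1, 3) ∀ p», FILE 5 = the FINITE game half,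
# the shape the typ-1 lineage's WINDOW HALF delivers)

[OURS · counted 0 · cell `res-dim4-pi` · K2(p) lane (holder res-dim4-p-12 g5); `(5,4)` instance: p-3 g4's `cInf_window_false`
(`T = 9`); game: `CInfGame.WindowPrime.no_play_after_change_of_le` (`L(C) = 4C + 2`, p-9 g3's clockwork); seat res-dim4-p-3 g5.]
Nothing here proves K2(p) for any `p`, any TAIL(p, p−1, 3), `NoIsolatedTrap p p`, the Cossart–Jannsen–Saito theorem or resolution
of singularities in dimension ≥ 4 / characteristic `p` — NOT proved.  AI kernel work, weaker than expert review.  Kills nothing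
by itself: the ENTRY (a straight frame with exact ledger at a letter change) and the WINDOW TRANSPORT (virtual pure-corner steps
shadowing the real translated/rotating tail) are the other two thirds of the line.

Letters `λ, μ` (slots), `u`, `f`; `d + 1 = p`, `2 ≤ d`; horizon `T + 1` states `c 0 … c (T+1)` with pure corner steps
`c (t+1) = step p univ (j t) 0 (c t)` in slot charts for `t ≤ T`, every state isolated of order `d + 2` with `e_G = 3` and ledger
`x_λ x_μ`, the first state straight at `f` in coefficients with the exact pair ledger, and the LETTER CHANGE `j 0 = λ`, `j 1 = μ`.
* `cInf_corner_window_invariant_prime` — straightness + exact ledger on the window (`t ≤ T + 1`).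
* **`no_cInf_corner_window_prime (p) (hdp : d + 1 = p) (hd2 : 2 ≤ d) (hT : 4 * (d − 1) + 2 ≤ T)`** — `False`.
[cite: CossartJannsenSaito2020, Thm. 3.14]
bears_on: LADDER-RESOLUTION:D157-DOOR2 (res-dim4-pi · K2(p) · power cones · C∞ window every prime).  Supports
stmt-ResolutionOfSingularities-16155 (helper).
-/

set_option linter.dupNamespace false -- mandated namespace of this single-conjunct summit

noncomputable section

namespace Summit.ResolutionOfSingularities.ResolutionOfSingularities.Theorems.PIDim4

namespace ResCone

open MvPolynomial Finset
open Literature.AlgebraicGeometry.Resolution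
open Literature.AlgebraicGeometry.Resolution.CentreBlowup
open Literature.AlgebraicGeometry.Resolution.Hauser2010
open Literature.AlgebraicGeometry.Resolution.HauserPerlega2019

variable {K : Type} [Field K] [DecidableEq K]
variable {la mu u f : Fin 4} (hlm : la ≠ mu) (hlu : la ≠ u) (hlf : la ≠ f) (hmu : mu ≠ u) (hmf : mu ≠ f)
  (huf : u ≠ f)
include hlm hlu hlf hmu hmf huf

omit hlu hmu huf in
/-- **STRAIGHTNESS AND THE EXACT PAIR LEDGER RIDE THE WINDOW, every prime** (finite-horizon form of
`cInf_corner_invariant_prime`). [OURS] [cite: CossartJannsenSaito2020, Thm. 3.14, Lemma 13.2] -/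
theorem cInf_corner_window_invariant_prime (p : ℕ) [Fact p.Prime] [CharP K p] {d : ℕ} (hdp : d + 1 = p) (hd2 : 2 ≤ d)
    {T : ℕ} {c : ℕ → State K} {j : ℕ → Fin 4}
    (ho : ∀ t, t ≤ T + 1 → ordZero (c t).F = ((d + 2 : ℕ) : ℕ∞))
    (he3 : ∀ t, t ≤ T + 1 → Module.finrank K (resVertex (c t)) = 3)
    (hdiv : ∀ t, t ≤ T + 1 → ∀ e ∈ (c t).F.support, (c t).r ≤ e)
    (hstep : ∀ t, t ≤ T → c (t + 1) = CentreBlowup.step p Finset.univ (j t) 0 (c t))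
    (hslot : ∀ t, t ≤ T → j t = la ∨ j t = mu)
    (hr : ∀ t, t ≤ T + 1 → (c t).r = Finsupp.single la 1 + Finsupp.single mu 1)
    (ha0 : coeff ((c 0).r + Finsupp.single f d) (c 0).F ≠ 0)
    (hstraight0 : ∀ m : Fin 4 →₀ ℕ, m.degree = d → m ≠ Finsupp.single f d → coeff ((c 0).r + m) (c 0).F = 0)
    (hled0 : ∀ e ∈ (c 0).F.support, e f ≤ d - 1 → 2 ≤ e la ∧ 2 ≤ e mu) :
    ∀ t, t ≤ T + 1 → coeff ((c t).r + Finsupp.single f d) (c t).F ≠ 0 ∧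
      (∀ m : Fin 4 →₀ ℕ, m.degree = d → m ≠ Finsupp.single f d → coeff ((c t).r + m) (c t).F = 0) ∧
      (∀ e ∈ (c t).F.support, e f ≤ d - 1 → 2 ≤ e la ∧ 2 ≤ e mu) := by
  intro t
  induction t with
  | zero => exact fun _ => ⟨ha0, hstraight0, hled0⟩
  | succ t ih =>
    intro ht
    obtain ⟨ha, hstraight, hled⟩ := ih (by omega)
    have ht' : t ≤ T := by omega
    have hrdeg : (c t).r.degree = 2 := by
      rw [hr t (by omega), map_add, Finsupp.degree_single, Finsupp.degree_single]
    have hrf : (c t).r f = 0 := by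
      rw [hr t (by omega), Finsupp.add_apply, Finsupp.single_eq_of_ne hlf.symm, Finsupp.single_eq_of_ne hmf.symm,
        add_zero]
    have h7 := succ_le_degree_of_straight_prime (by omega) (ho t (by omega)) (hdiv t (by omega)) hrdeg hrf hstraight
    have hrswap : (c t).r = Finsupp.single mu 1 + Finsupp.single la 1 := by rw [hr t (by omega), add_comm]
    have hr' : (c (t + 1)).r = (c t).r := by rw [hr (t + 1) ht, hr t (by omega)]
    have hst := hstep t ht'
    rcases hslot t ht' with hj | hj <;> rw [hj] at hst
    · have ho' : ordZero (CentreBlowup.step p Finset.univ la 0 (c t)).F = ((d + 2 : ℕ) : ℕ∞) := by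
        rw [← hst]; exact ho (t + 1) ht
      have he3' : Module.finrank K (resVertex (CentreBlowup.step p Finset.univ la 0 (c t))) = 3 := by
        rw [← hst]; exact he3 (t + 1) ht
      obtain ⟨hz, hx, -⟩ := cInf_legal_readings_of_corner_prime p hdp hd2 hlm hlf hmf (hr t (by omega)) (hdiv t (by omega))
        (ho t (by omega)) ha hstraight (tsch_row_of_ledger_prime hlm hlf hmf (hr t (by omega))
        (fun e he hef => (hled e he hef).2)) ho' he3'
      refine ⟨?_, fun m hm hne => ?_, ?_⟩
      · rw [hr', hst, hx]; exact ha
      · rw [hr', hst]; exact hz m hm hne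
      · rw [hst]; exact ledger_step_zero_prime hlm hlf p hdp (c t) h7 hled
    · have ho' : ordZero (CentreBlowup.step p Finset.univ mu 0 (c t)).F = ((d + 2 : ℕ) : ℕ∞) := by
        rw [← hst]; exact ho (t + 1) ht
      have he3' : Module.finrank K (resVertex (CentreBlowup.step p Finset.univ mu 0 (c t))) = 3 := by
        rw [← hst]; exact he3 (t + 1) ht
      obtain ⟨hz, hx, -⟩ := cInf_legal_readings_of_corner_prime p hdp hd2 (Ne.symm hlm) hmf hlf hrswap (hdiv t (by omega))
        (ho t (by omega)) ha hstraight (tsch_row_of_ledger_prime (Ne.symm hlm) hmf hlf hrswap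
        (fun e he hef => (hled e he hef).1)) ho' he3'
      refine ⟨?_, fun m hm hne => ?_, ?_⟩
      · rw [hr', hst, hx]; exact ha
      · rw [hr', hst]; exact hz m hm hne
      · rw [hst]
        intro e he hef
        exact (ledger_step_zero_prime (Ne.symm hlm) hmf p hdp (c t) h7 (fun e' he' hef' => (hled e' he' hef').symm)
          e he hef).symm

/-- **THE C∞ WINDOW CANNOT BE PLAYED, EVERY PRIME** (the finite game half).  `d + 1 = p`, `2 ≤ d`, `T ≥ 4(d − 1) + 2`; states
`c 0 … c (T+1)` and slot charts `j 0 … j T` with pure corner steps, every state ISOLATED of order `d + 2` with `e_G = 3`, ledger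
`r_t = x_λ x_μ ∣ F_t`, the first state straight at `f` (coefficients) with the exact pair ledger, and the LETTER CHANGE
`j 0 = λ`, `j 1 = μ`.  Then `False`: the supports `P t (c,a,b,e) :⟺ c + 1 ≤ d ∧ coeff ((a+2)λ+(b+2)μ+e·u+(d−1−c)f) F_t ≠ 0`
along `x t := (j t = λ)` are a legal doubly-flagged play on `[0, T]`, against `CInfGame.WindowPrime.no_play_after_change_of_le`
with `C := d − 1`. [OURS] [cite: CossartJannsenSaito2020, Thm. 3.14] -/
theorem no_cInf_corner_window_prime (p : ℕ) [Fact p.Prime] [CharP K p] {d : ℕ} (hdp : d + 1 = p) (hd2 : 2 ≤ d)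
    {T : ℕ} (hT : 4 * (d - 1) + 2 ≤ T) {c : ℕ → State K} {j : ℕ → Fin 4}
    (hiso : ∀ t, t ≤ T + 1 → IsIsolated p (c t).F)
    (ho : ∀ t, t ≤ T + 1 → ordZero (c t).F = ((d + 2 : ℕ) : ℕ∞))
    (he3 : ∀ t, t ≤ T + 1 → Module.finrank K (resVertex (c t)) = 3)
    (hdiv : ∀ t, t ≤ T + 1 → ∀ e ∈ (c t).F.support, (c t).r ≤ e)
    (hstep : ∀ t, t ≤ T → c (t + 1) = CentreBlowup.step p Finset.univ (j t) 0 (c t))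
    (hslot : ∀ t, t ≤ T → j t = la ∨ j t = mu)
    (hr : ∀ t, t ≤ T + 1 → (c t).r = Finsupp.single la 1 + Finsupp.single mu 1)
    (ha0 : coeff ((c 0).r + Finsupp.single f d) (c 0).F ≠ 0)
    (hstraight0 : ∀ m : Fin 4 →₀ ℕ, m.degree = d → m ≠ Finsupp.single f d → coeff ((c 0).r + m) (c 0).F = 0)
    (hled0 : ∀ e ∈ (c 0).F.support, e f ≤ d - 1 → 2 ≤ e la ∧ 2 ≤ e mu)
    (hx0 : j 0 = la) (hx1 : j 1 = mu) : False := by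
  classical
  have hinv := cInf_corner_window_invariant_prime hlm hlf hmf p hdp hd2 ho he3 hdiv hstep hslot hr ha0 hstraight0 hled0
  have hrswap : ∀ t, t ≤ T + 1 → (c t).r = Finsupp.single mu 1 + Finsupp.single la 1 := fun t ht => by
    rw [hr t ht, add_comm]
  have hla1 : ∀ t, t ≤ T + 1 → ∀ e ∈ (c t).F.support, 1 ≤ e la := fun t ht e he => by
    have h := hdiv t ht e he la
    rw [hr t ht, Finsupp.add_apply, Finsupp.single_eq_same, Finsupp.single_eq_of_ne hlm] at h
    omega
  have hmu1 : ∀ t, t ≤ T + 1 → ∀ e ∈ (c t).F.support, 1 ≤ e mu := fun t ht e he => by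
    have h := hdiv t ht e he mu
    rw [hr t ht, Finsupp.add_apply, Finsupp.single_eq_of_ne (Ne.symm hlm), Finsupp.single_eq_same] at h
    omega
  -- legality at a step `t ≤ T` in the chart `κ ∈ {λ, μ}`
  have hleg : ∀ t, t ≤ T → ∀ {κ o : Fin 4}, κ ≠ o → κ ≠ u → κ ≠ f → o ≠ u → o ≠ f → j t = κ →
      (c t).r = Finsupp.single κ 1 + Finsupp.single o 1 →
      (∀ e ∈ (c t).F.support, e f ≤ d - 1 → 2 ≤ e o) →
      ∀ {cc : ℕ}, cc + 1 ≤ d → ∀ {a b e : ℕ},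
        coeff (Finsupp.single κ (a + 2) + Finsupp.single o (b + 2) + Finsupp.single u e +
          Finsupp.single f (d - 1 - cc)) (c t).F ≠ 0 → 2 * cc ≤ a + 2 * b + 2 * e := by
    intro t ht κ o hκo hκu hκf hou hof hj hrκ hledo cc hcc a b e h
    obtain ⟨ha, hstraight, -⟩ := hinv t (by omega)
    have hst := hstep t ht
    rw [hj] at hst
    have ho' : ordZero (CentreBlowup.step p Finset.univ κ 0 (c t)).F = ((d + 2 : ℕ) : ℕ∞) := by
      rw [← hst]; exact ho (t + 1) (by omega)
    have he3' : Module.finrank K (resVertex (CentreBlowup.step p Finset.univ κ 0 (c t))) = 3 := by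
      rw [← hst]; exact he3 (t + 1) (by omega)
    exact cInf_hleg_of_corner_prime hκo hκu hκf hou hof huf p hdp hd2 hrκ (hdiv t (by omega)) (ho t (by omega)) ha hstraight
      (tsch_row_of_ledger_prime hκo hκf hof hrκ hledo) ho' he3' hcc h
  refine CInfGame.WindowPrime.no_play_after_change_of_le (d - 1) T (by omega) hT (fun t => decide (j t = la))
    (fun t m => m.1 + 1 ≤ d ∧ coeff (Finsupp.single la (m.2.1 + 2) + Finsupp.single mu (m.2.2.1 + 2) +
      Finsupp.single u m.2.2.2 + Finsupp.single f (d - 1 - m.1)) (c t).F ≠ 0)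
    (by simp [hx0]) (by simp [hx1, Ne.symm hlm]) (fun t cc a b e hP => by have := hP.1; omega) ?_ ?_ ?_ ?_ ?_ ?_ ?_
  · -- hfwdL
    intro t cc a b e ht hP hx hnd
    dsimp only at hP ⊢
    have hj : j t = la := of_decide_eq_true hx
    have hst := hstep t (by omega)
    rw [hj] at hst
    refine ⟨hP.1, ?_⟩
    rw [hst]
    exact coeff_step_zero_gameExp_ne_zero_prime hlm hlu hlf hmu hmf huf p hdp (c t)
      (by rw [ordAlong_univ, ho t (by omega)]; exact_mod_cast (by omega : p ≤ d + 2))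
      (le_degree_of_ordZero_eq (ho t (by omega)))
      (straight_support_of_straight_prime (hdiv t (by omega)) (by rw [hr t (by omega), map_add]; simp)
        (by rw [hr t (by omega), Finsupp.add_apply, Finsupp.single_eq_of_ne hlf.symm, Finsupp.single_eq_of_ne hmf.symm,
          add_zero]) (hinv t (by omega)).2.1) hP.1 hP.2 hnd
  · -- hfwdM
    intro t cc a b e ht hP hx hnd
    dsimp only at hP ⊢
    have hj : j t = mu := by
      rcases hslot t (by omega) with h | h
      · exact absurd (decide_eq_true h) (by rw [hx]; exact Bool.false_ne_true)
      · exact h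
    have hst := hstep t (by omega)
    rw [hj] at hst
    refine ⟨hP.1, ?_⟩
    have h := hP.2
    rw [gameExp_swap] at h
    have himg := coeff_step_zero_gameExp_ne_zero_prime (Ne.symm hlm) hmu hmf hlu hlf huf p hdp (c t)
      (by rw [ordAlong_univ, ho t (by omega)]; exact_mod_cast (by omega : p ≤ d + 2))
      (le_degree_of_ordZero_eq (ho t (by omega)))
      (straight_support_of_straight_prime (hdiv t (by omega)) (by rw [hr t (by omega), map_add]; simp)
        (by rw [hr t (by omega), Finsupp.add_apply, Finsupp.single_eq_of_ne hlf.symm, Finsupp.single_eq_of_ne hmf.symm,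
          add_zero]) (hinv t (by omega)).2.1) hP.1 h (by omega)
    rw [hst, gameExp_swap, show a + b + e - cc = b + a + e - cc by rw [Nat.add_comm a b]]
    exact himg
  · -- hlegL
    intro t cc a b e ht hP hx
    dsimp only at hP
    have hj : j t = la := of_decide_eq_true hx
    exact hleg t ht hlm hlu hlf hmu hmf hj (hr t (by omega)) (fun e he hef => ((hinv t (by omega)).2.2 e he hef).2) hP.1 hP.2
  · -- hlegM
    intro t cc a b e ht hP hx
    dsimp only at hP
    have hj : j t = mu := by
      rcases hslot t ht with h | h
      · exact absurd (decide_eq_true h) (by rw [hx]; exact Bool.false_ne_true)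
      · exact h
    have h := hP.2
    rw [gameExp_swap] at h
    have := hleg t ht (Ne.symm hlm) hmu hmf hlu hlf hj (hrswap t (by omega))
      (fun e he hef => ((hinv t (by omega)).2.2 e he hef).1) hP.1 h
    omega
  · -- hevol
    intro t cc a b e ht hP
    dsimp only at hP ⊢
    have hst := hstep t (by omega)
    right
    rcases hslot t (by omega) with hj | hj
    · rw [hj] at hst
      have h := hP.2
      rw [hst] at h
      obtain ⟨a₀, ha₀, heq⟩ := cInf_hevol_of_corner_prime hlm hlu hlf hmu hmf huf p hdp (c t) (hla1 t (by omega))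
        (fun e he hef => ((hinv t (by omega)).2.2 e he hef).1) hP.1 h
      exact ⟨a₀, b, ⟨hP.1, ha₀⟩, Or.inl ⟨decide_eq_true hj, by omega, rfl⟩⟩
    · rw [hj] at hst
      have h := hP.2
      rw [hst, gameExp_swap] at h
      obtain ⟨b₀, hb₀, heq⟩ := cInf_hevol_of_corner_prime (Ne.symm hlm) hmu hmf hlu hlf huf p hdp (c t) (hmu1 t (by omega))
        (fun e he hef => ((hinv t (by omega)).2.2 e he hef).2) hP.1 h
      rw [gameExp_swap] at hb₀
      have hx : decide (j t = la) = false := by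
        rw [decide_eq_false_iff_not, hj]; exact Ne.symm hlm
      exact ⟨a, b₀, ⟨hP.1, hb₀⟩, Or.inr ⟨hx, rfl, by omega⟩⟩
  · -- hflagL
    intro t h2 hT'
    obtain ⟨cc, a, b, e, hcc, h, hb⟩ := cInf_hflag_of_isolated_prime hlm hlu hlf hmu hmf huf p hdp (hiso t (by omega))
      (hdiv t (by omega)) (hr t (by omega)) (hinv t (by omega)).2.2
    exact ⟨cc, a, b, e, ⟨hcc, h⟩, hb⟩
  · -- hflagM
    intro t h2 hT'
    obtain ⟨cc, a, b, e, hcc, h, hb⟩ := cInf_hflag_of_isolated_prime (Ne.symm hlm) hmu hmf hlu hlf huf p hdp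
      (hiso t (by omega)) (hdiv t (by omega)) (hrswap t (by omega)) (fun e he hef => ((hinv t (by omega)).2.2 e he hef).symm)
    rw [gameExp_swap] at h
    exact ⟨cc, b, a, e, ⟨hcc, h⟩, hb⟩

end ResCone

end Summit.ResolutionOfSingularities.ResolutionOfSingularities.Theorems.PIDim4

end
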